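import Literature.Topology.FourManifolds.LinkLeeSaddleCanonical
import Literature.Topology.FourManifolds.LinkLeeBirthDeathCanonical
import Literature.Topology.FourManifolds.LinkGaussDiagramsRelabel
import HarnessLib

/-!
# Movies of link Gauss diagrams and their composite Lee chain maps (link tower, layer T7a)

The COMBINATORIAL MOVIE layer of the link tower `LinkGaussDiagrams` (D1: `birth`, `death`,
`saddle p q`, `unknots`, `ofGaussDiagram`) → `LinkKhComplex` (D2b: `degStates`, `khovanovD`,
`leeCycles`, `qMin`) → `LinkLeeStates` (D2c: `IsCheckerboard`, `leeState`, `leeMonomial`) →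
`LinkKhBirthDeath` (T4a: `birthMap`, `deathMap`), `LinkKhSaddleChain` (T4b: `saddleMap`),
`LinkGaussDiagramsRelabel` (`relabel τ κ`, `transportEquiv`, Koszul potentials) → **this file**:
a finite movie of elementary moves between link Gauss diagrams, the composite of the chain maps
of its moves on Lee's complex, and its three structural properties — chain map (cycles to
cycles, boundaries to boundaries), filtered of degree `χ` (Rasmussen (2010), §4.2), transport
of checkerboard colourings — in the shapes consumed by the assembly
`eq_zero_of_isSmoothlySlice_of_canonical_unknotOne` (`LinkKhUnknotOne`). The tracking of
Lee's canonical generators along a movie (Rasmussen's Prop. 4.1 ⇒ Cor. 4.2) is the sequel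
`LinkKhMovieCanonical`.

## Conventions

* **Lee's theory** is the specialisation `(R, h, t) = (ℚ, 0, 1)` of `khovanovD`, as in
  `leeD`, `leeCycles = ker (khovanovD ℚ 0 1 0 (0 + 1))`, boundaries
  `range (khovanovD ℚ 0 1 (0 - 1) 0)`; all maps of this file are `ℚ`-linear maps of the
  cochain groups `degStates i → ℚ`, in EVERY homological degree `i` (`Step.map s i`,
  `Movie.map m i`; the consumer uses `i = 0`).
* **Elementary moves** (`Step L L'`, a `Type`-valued inductive family): `birth L : L ⟶ L.birth`
  (unit `ι = birthMap`), `death L : L.birth ⟶ L` (counit `ε = deathMap`, typed on `L.birth` as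
  in `LinkKhBirthDeath`), `saddle L p q hpq : L ⟶ L.saddle p q` (the oriented band
  `saddleMap p q 0 1` between the arcs leaving the marked points `p ≠ q`),
  `relabel L τ κ φ : L ⟶ L.relabel τ κ`
  (renumbering of marked points, chords and free circles; its map `relabelMap` is the SIGNED
  transport `transportEquiv` of `LinkGaussDiagramsRelabel` along `enhancedStateRelabelEquiv`
  with a chosen Koszul potential `relabelSign` of `κ`, a chain ISOMORPHISM). A `Movie L L'` is a
  composable list of steps; `Movie.map` composes the maps. Reidemeister moves between link
  diagrams are not steps of this layer (they change `n`; every step here keeps `n`,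
  `Movie.n_eq`), so a movie of this file presents a cobordism without Reidemeister moves.
* **Degree shift** `degShift` (Rasmussen's `χ`): `birth ↦ +1`, `death ↦ +1`, `saddle ↦ -1`,
  `relabel ↦ 0`, summed along a movie — the conventions of `le_qMin_birthMap`,
  `le_qMin_deathMap` (`+1`) and `le_qMin_saddleMap` (`-1`): `Movie.map m 0` is filtered of degree
  `m.degShift` (`Movie.le_qMin_map`), i.e. `χ(S) = #births - #saddles + #deaths` of the surface.
* **Chain-map hypotheses.** `birthMap`, `deathMap`, `relabelMap` are chain maps outright; the
  saddle needs the merge-or-split inputs `hms`, `hms'`, `hsad` of `khovanovD_comp_saddleMap`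
  (realisability). `Movie.MergeOrSplit m` records them at every saddle of `m`; then
  `Movie.khovanovD_comp_map` (`d ∘ map i = map i' ∘ d`), `Movie.map_mem_leeCycles`,
  `Movie.map_mem_range`, packaged with the filtration as `Movie.isFilteredLeeMap`
  (`IsFilteredLeeMap d F`, closed under composition — the interface a future Reidemeister step
  plugs into).
* **Bookkeeping.** `birthCount`, `deathCount`, `saddleCount` with
  `degShift = #births - #saddles + #deaths` (`Movie.degShift_eq`); the transports `push` /
  `pull` of free-circle labels along steps (forgetting / renumbering), `pull` surjective
  without deaths — used by the tracking of canonical generators in `LinkKhMovieCanonical`.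
* **Colour transport.** A colouring `c : Fin (2n) → Bool` of the marked points is carried
  along a step by `Step.colour` (unchanged by births, deaths and saddles — same marked points —
  and `c ∘ τ⁻¹` after `relabel τ κ φ`) and along a movie by `Movie.colour`. A movie is
  **coherent** for `c` (`Movie.Coherent m c`) if every saddle `(p, q)` met along the way joins
  arcs of the same transported colour (`c p = c q`, an ORIENTED band, `IsCheckerboard.saddle`)
  and is a merge or a split in every state (`hsad`). For a checkerboard colouring `c`
  (`IsCheckerboard`), coherence transports the checkerboard property to the end
  (`IsCheckerboard.movie`) and discharges `hms`, `hms'` (`LinkKhDichotomy`), leaving exactly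
  the `hsad` inputs: `Movie.Coherent.mergeOrSplit`.

## References

* J. Rasmussen, *Khovanov homology and the slice genus*, Invent. Math. 182 (2010) 419–447,
  §4.1 (elementary cobordisms), §4.2 (induced maps, filtered of degree `χ`), Prop. 4.1,
  Cor. 4.2. [cite: Rasmussen2010, §4]
* M. Khovanov, *A categorification of the Jones polynomial*, Duke Math. J. 101 (2000), §3.3
  (independence of the ordering: Koszul signs), §6 (cobordisms). [cite: Khovanov2000, §6]
* M. Jacobsson, *An invariant of link cobordisms from Khovanov homology*, Algebr. Geom.
  Topol. 4 (2004), §3 (movies). [cite: Jacobsson2004, §3]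
* D. Bar-Natan, *Khovanov's homology for tangles and cobordisms*, Geom. Topol. 9 (2005), §8
  (movies and movie moves). [cite: BarNatan2005, §8]
-/

open Function Set

noncomputable section

namespace Literature.Topology.FourManifolds

namespace LinkGaussDiagram

variable {L L' L'' : LinkGaussDiagram}

/-! ## Filtered Lee chain maps in degree zero (the composable interface) -/

/-- A linear map of degree-zero Lee chains `F : C⁰(L) → C⁰(L')` is a **filtered Lee map of
degree `d`**: it sends degree-zero Lee cycles to cycles, degree-zero boundaries to boundaries,
and is filtered of `q`-degree `d` in the integer shape of `le_qMin_birthMap` /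
`le_qMin_saddleMap` (`k ≤ q(x) ⟹ k + d ≤ q(F x)`). The maps induced by cobordisms are such
(Rasmussen (2010), §4.2: "`φ_S` is a filtered map of degree `χ(S)`").
[cite: Rasmussen2010, §4] -/
structure IsFilteredLeeMap (L L' : LinkGaussDiagram) (d : ℤ)
    (F : (L.degStates 0 → ℚ) →ₗ[ℚ] (L'.degStates 0 → ℚ)) : Prop where
  /-- Degree-zero Lee cycles go to cycles. [cite: Rasmussen2010, §4] -/
  mem_leeCycles : ∀ z ∈ L.leeCycles, F z ∈ L'.leeCycles
  /-- Degree-zero Lee boundaries go to boundaries. [cite: Rasmussen2010, §4] -/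
  mem_range : ∀ x ∈ LinearMap.range (L.khovanovD ℚ 0 1 (0 - 1) 0),
    F x ∈ LinearMap.range (L'.khovanovD ℚ 0 1 (0 - 1) 0)
  /-- The map is filtered of `q`-degree `d`. [cite: Rasmussen2010, §4] -/
  le_qMin : ∀ (x : L.degStates 0 → ℚ) (k : ℤ),
    ((k : WithTop ℤ) : WithBot (WithTop ℤ)) ≤ qMin x →
      (((k + d : ℤ) : WithTop ℤ) : WithBot (WithTop ℤ)) ≤ qMin (F x)

/-- The identity is a filtered Lee map of degree `0`. [folklore] -/
theorem IsFilteredLeeMap.id (L : LinkGaussDiagram) : IsFilteredLeeMap L L 0 LinearMap.id where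
  mem_leeCycles _ hz := hz
  mem_range _ hx := hx
  le_qMin x k hk := by rwa [add_zero]

/-- **Filtered Lee maps compose, degrees add** (`χ` is additive under gluing of cobordisms).
[cite: Rasmussen2010, §4] -/
theorem IsFilteredLeeMap.comp {d d' : ℤ}
    {F : (L.degStates 0 → ℚ) →ₗ[ℚ] (L'.degStates 0 → ℚ)}
    {F' : (L'.degStates 0 → ℚ) →ₗ[ℚ] (L''.degStates 0 → ℚ)}
    (hF' : IsFilteredLeeMap L' L'' d' F') (hF : IsFilteredLeeMap L L' d F) :
    IsFilteredLeeMap L L'' (d + d') (F' ∘ₗ F) where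
  mem_leeCycles z hz := hF'.mem_leeCycles _ (hF.mem_leeCycles z hz)
  mem_range x hx := hF'.mem_range _ (hF.mem_range x hx)
  le_qMin x k hk := by
    rw [← add_assoc]
    exact hF'.le_qMin _ _ (hF.le_qMin x k hk)

/-- **The filtration degree of a nonzero degree-zero chain is an honest integer**, the least
quantum degree of a state in its support (link version of `GaussDiagram.exists_qMin_eq_coe`).
[cite: Rasmussen2010, §2] -/
theorem exists_qMin_eq_coe {x : L.degStates 0 → ℚ} (hx : x ≠ 0) :
    ∃ s, x s ≠ 0 ∧ qMin x = ((qDegree s.1 : WithTop ℤ) : WithBot (WithTop ℤ)) := by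
  classical
  have hne : (Finset.univ.filter fun s : L.degStates 0 ↦ x s ≠ 0).Nonempty := by
    by_contra h
    rw [Finset.not_nonempty_iff_eq_empty, Finset.filter_eq_empty_iff] at h
    exact hx (funext fun s ↦ not_not.1 (h (Finset.mem_univ s)))
  obtain ⟨s, hs, hmin⟩ := Finset.exists_min_image _ (fun s : L.degStates 0 ↦ qDegree s.1) hne
  rw [Finset.mem_filter] at hs
  refine ⟨s, hs.2, le_antisymm (iInf₂_le s hs.2) ?_⟩
  rw [coe_le_qMin_iff_qDegree]
  exact fun s' hs' ↦ hmin s' (Finset.mem_filter.2 ⟨Finset.mem_univ _, hs'⟩)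

/-- The zero chain has filtration degree `⊤` (empty support). [folklore] -/
theorem qMin_zero (L : LinkGaussDiagram) : qMin (0 : L.degStates 0 → ℚ) = ⊤ := by
  simp [qMin]

/-- **A filtered Lee map of nonnegative degree does not decrease `qMin`** — the shape
`∀ x, qMin x ≤ qMin (F x)` of hypothesis (iii) of `eq_zero_of_isSmoothlySlice_of_canonical`
(for a concordance `χ = 0`). [cite: Rasmussen2010, §4] -/
theorem IsFilteredLeeMap.qMin_le {d : ℤ}
    {F : (L.degStates 0 → ℚ) →ₗ[ℚ] (L'.degStates 0 → ℚ)} (hF : IsFilteredLeeMap L L' d F)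
    (hd : 0 ≤ d) (x : L.degStates 0 → ℚ) : qMin x ≤ qMin (F x) := by
  by_cases hx : x = 0
  · rw [hx, map_zero, qMin_zero, qMin_zero]
  · obtain ⟨s, -, hq⟩ := exists_qMin_eq_coe hx
    have h := hF.le_qMin x (qDegree s.1) hq.ge
    rw [hq]
    exact le_trans (WithBot.coe_le_coe.2 (WithTop.coe_le_coe.2 (by omega))) h

/-- Cycles to cycles from a commutation `d₀' ∘ F₀ = F₁ ∘ d₀`. [folklore] -/
theorem mem_leeCycles_of_comm {F₀ : (L.degStates 0 → ℚ) →ₗ[ℚ] (L'.degStates 0 → ℚ)}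
    {F₁ : (L.degStates (0 + 1) → ℚ) →ₗ[ℚ] (L'.degStates (0 + 1) → ℚ)}
    (h : L'.khovanovD ℚ 0 1 0 (0 + 1) ∘ₗ F₀ = F₁ ∘ₗ L.khovanovD ℚ 0 1 0 (0 + 1))
    {z : L.degStates 0 → ℚ} (hz : z ∈ L.leeCycles) : F₀ z ∈ L'.leeCycles := by
  rw [LinearMap.mem_ker] at hz ⊢
  rw [← LinearMap.comp_apply, h, LinearMap.comp_apply, hz, map_zero]

/-- Boundaries to boundaries from a commutation `d₋₁' ∘ F₋₁ = F₀ ∘ d₋₁`.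
[folklore] -/
theorem mem_range_of_comm
    {F : (L.degStates (0 - 1) → ℚ) →ₗ[ℚ] (L'.degStates (0 - 1) → ℚ)}
    {F₀ : (L.degStates 0 → ℚ) →ₗ[ℚ] (L'.degStates 0 → ℚ)}
    (h : L'.khovanovD ℚ 0 1 (0 - 1) 0 ∘ₗ F = F₀ ∘ₗ L.khovanovD ℚ 0 1 (0 - 1) 0)
    {x : L.degStates 0 → ℚ} (hx : x ∈ LinearMap.range (L.khovanovD ℚ 0 1 (0 - 1) 0)) :
    F₀ x ∈ LinearMap.range (L'.khovanovD ℚ 0 1 (0 - 1) 0) := by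
  obtain ⟨y, rfl⟩ := hx
  exact ⟨F y, LinearMap.congr_fun h y⟩

/-! ## The relabelling step: a signed chain isomorphism -/

section Relabel

variable (L) (τ : Equiv.Perm (Fin (2 * L.n))) (κ : Equiv.Perm (Fin L.n))
  (φ : Equiv.Perm (Fin L.free))

/-- **A Koszul potential of the chord renumbering `κ`** over `ℚ` (a choice, by
`exists_isKoszulPotential_relabelTransfer`): signs `ε σ = ±1` on the states whose coboundary is
the change of the Koszul signs of the cube under `κ`. Khovanov (2000), §3.3.
[cite: Khovanov2000, §3.3] -/
def relabelSign : L.State → ℚ :=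
  Classical.choose (L.exists_isKoszulPotential_relabelTransfer τ κ φ ℚ)

/-- The chosen signs are a Koszul potential for the transfer data of the relabelling.
[cite: Khovanov2000, §3.3] -/
theorem isKoszulPotential_relabelSign :
    (L.relabelTransfer τ κ φ).IsKoszulPotential (L.relabelSign τ κ φ) :=
  Classical.choose_spec (L.exists_isKoszulPotential_relabelTransfer τ κ φ ℚ)

/-- The chosen signs square to `1`. [folklore] -/
theorem relabelSign_mul_self (σ : L.State) :
    L.relabelSign τ κ φ σ * L.relabelSign τ κ φ σ = 1 :=
  (L.isKoszulPotential_relabelSign τ κ φ).1 σ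

/-- The chosen signs are nonzero. [folklore] -/
theorem relabelSign_ne_zero (σ : L.State) : L.relabelSign τ κ φ σ ≠ 0 :=
  left_ne_zero_of_mul_eq_one (L.relabelSign_mul_self τ κ φ σ)

/-- **The chain isomorphism of a relabelling** `C^i(L) ≃ C^i(L.relabel τ κ)`: the signed
transport `s ↦ ε (s.state) · Φ s` of `LinkGaussDiagramsRelabel` along the bijection of enhanced
states `Φ = enhancedStateRelabelEquiv τ κ φ` with the Koszul potential `relabelSign`. It is the
map induced by the trivial (cylinder) cobordism read with renumbered data. Khovanov (2000),
§3.3. [cite: Khovanov2000, §3.3] -/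
def relabelMap (i : ℤ) :
    (L.degStates i → ℚ) ≃ₗ[ℚ] ((L.relabel τ κ).degStates i → ℚ) :=
  transportEquiv (L.enhancedStateRelabelEquiv τ κ φ)
    (fun s ↦ (L.relabelTransfer τ κ φ).homDegree_enhancedMap s)
    (fun s ↦ L.relabelSign τ κ φ s.state) (fun s ↦ L.relabelSign_mul_self τ κ φ s.state) i

/-- **The relabelling map is a chain map** (indeed a chain isomorphism) for every Frobenius
system over `ℚ`: `R_{i'} ∘ d = d' ∘ R_i` (`transportEquiv_comp_khovanovD` with
`Transfer.incidence_enhancedEquiv`). Khovanov (2000), §3.3. [cite: Khovanov2000, §3.3] -/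
theorem relabelMap_comp_khovanovD (h t : ℚ) (i i' : ℤ) :
    (L.relabelMap τ κ φ i').toLinearMap ∘ₗ L.khovanovD ℚ h t i i' =
      (L.relabel τ κ).khovanovD ℚ h t i i' ∘ₗ (L.relabelMap τ κ φ i).toLinearMap :=
  transportEquiv_comp_khovanovD (L.enhancedStateRelabelEquiv τ κ φ)
    (fun s ↦ (L.relabelTransfer τ κ φ).homDegree_enhancedMap s)
    (fun s ↦ L.relabelSign τ κ φ s.state) (fun s ↦ L.relabelSign_mul_self τ κ φ s.state)
    h t ((L.relabelTransfer τ κ φ).incidence_enhancedEquiv h t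
      (L.isKoszulPotential_relabelSign τ κ φ)) i i'

/-- The same commutation in the orientation `d' ∘ R_i = R_{i'} ∘ d` used for the other steps.
[cite: Khovanov2000, §3.3] -/
theorem khovanovD_comp_relabelMap (h t : ℚ) (i i' : ℤ) :
    (L.relabel τ κ).khovanovD ℚ h t i i' ∘ₗ (L.relabelMap τ κ φ i).toLinearMap =
      (L.relabelMap τ κ φ i').toLinearMap ∘ₗ L.khovanovD ℚ h t i i' :=
  (L.relabelMap_comp_khovanovD τ κ φ h t i i').symm

/-- **The relabelling map preserves the filtration degree** (supports correspond, the signs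
are units, `qDegree` is transported). [cite: Rasmussen2010, §2] -/
theorem qMin_relabelMap (x : L.degStates 0 → ℚ) : qMin (L.relabelMap τ κ φ 0 x) = qMin x :=
  qMin_transportEquiv (L.enhancedStateRelabelEquiv τ κ φ)
    (fun s ↦ (L.relabelTransfer τ κ φ).homDegree_enhancedMap s)
    (fun s ↦ L.relabelSign τ κ φ s.state) (fun s ↦ L.relabelSign_mul_self τ κ φ s.state)
    (fun s ↦ (L.relabelTransfer τ κ φ).qDegree_enhancedMap s) x

/-- The relabelling map in degree `0` is a filtered Lee map of degree `0`.
[cite: Rasmussen2010, §4] -/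
theorem isFilteredLeeMap_relabelMap :
    IsFilteredLeeMap L (L.relabel τ κ) 0 (L.relabelMap τ κ φ 0).toLinearMap where
  mem_leeCycles _ hz :=
    mem_leeCycles_of_comm (L.khovanovD_comp_relabelMap τ κ φ 0 1 0 (0 + 1)) hz
  mem_range _ hx := mem_range_of_comm (L.khovanovD_comp_relabelMap τ κ φ 0 1 (0 - 1) 0) hx
  le_qMin x k hk := by
    rw [add_zero, LinearEquiv.coe_coe, qMin_relabelMap]
    exact hk

/-- The bijection of enhanced states of a relabelling is the transport of its transfer data
(definitional unfolding, for rewriting). [folklore] -/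
theorem enhancedStateRelabelEquiv_apply (s : L.EnhancedState) :
    L.enhancedStateRelabelEquiv τ κ φ s = (L.relabelTransfer τ κ φ).enhancedMap s := rfl

end Relabel

/-! ## Transport of Lee monomials along transfer data -/

namespace Transfer

variable (T : Transfer L L')

/-- Transport of states along transfer data is injective. [folklore] -/
theorem stateMap_injective : Injective T.stateMap :=
  fun _ _ h ↦ T.chord.symm.surjective.injective_comp_right h

/-- **`pairCount` is transported**: the circles of `σ` labelled `(λ = 1, ℓ = 𝐛)` correspond
under `circleEquiv` to those of the transported state for the transported labellings.
[cite: Lee2005, §4] -/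
theorem pairCount_stateMap (σ : L.State) (lam ell : L.Arc → Bool) :
    L'.pairCount (T.stateMap σ) (lam ∘ ⇑T.arc.symm) (ell ∘ ⇑T.arc.symm) =
      L.pairCount σ lam ell := by
  unfold pairCount
  symm
  refine Finset.card_equiv (T.circleEquiv σ) fun C ↦ ?_
  simp only [Finset.mem_filter, Finset.mem_univ, true_and, Function.comp_apply]
  constructor
  · rintro ⟨a, rfl, ha⟩
    exact ⟨T.arc a, (T.circleEquiv_circleOf σ a).symm, by simpa using ha⟩
  · rintro ⟨a', ha', hl⟩
    refine ⟨T.arc.symm a', (T.circleEquiv σ).injective ?_, hl⟩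
    rw [T.circleEquiv_circleOf, Equiv.apply_symm_apply]
    exact ha'

/-- **Lee monomials are transported to Lee monomials** along transfer data (same state fibre,
`pairCount_stateMap`): the coefficient of `Φ s₁` in the monomial of `Φ s` is that of `s₁` in
the monomial of `s`. Lee (2005), §4.4. [cite: Lee2005, §4] -/
theorem leeMonomial_enhancedMap (k : ℤ) (s : L.EnhancedState) (s₁ : L.degStates k)
    (s' : L'.degStates k) (hs' : s'.1 = T.enhancedMap s₁.1) :
    L'.leeMonomial k (T.enhancedMap s) s' = L.leeMonomial k s s₁ := by
  unfold leeMonomial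
  rw [hs']
  simp only [enhancedMap_state, enhancedMap_label, T.stateMap_injective.eq_iff]
  split_ifs with hσ
  · rw [← hσ, T.pairCount_stateMap]
  · rfl

end Transfer

section RelabelLee

variable (L) (τ : Equiv.Perm (Fin (2 * L.n))) (κ : Equiv.Perm (Fin L.n))
  (φ : Equiv.Perm (Fin L.free))

/-- **The relabelling map on Lee monomials**:
`R (leeMonomial i s) = ε(σ) • leeMonomial i (Φ s)` — the transported monomial, up to the
Koszul sign of the state `σ` of `s` (the monomial is supported on the fibre of `σ`, where the
sign is constant). [cite: Lee2005, §4] -/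
theorem relabelMap_leeMonomial (i : ℤ) (s : L.EnhancedState) :
    L.relabelMap τ κ φ i (L.leeMonomial i s) = L.relabelSign τ κ φ s.state •
      (L.relabel τ κ).leeMonomial i (L.enhancedStateRelabelEquiv τ κ φ s) := by
  ext s'
  obtain ⟨s₁, rfl⟩ := (transportDegEquiv (L.enhancedStateRelabelEquiv τ κ φ)
    (fun s ↦ (L.relabelTransfer τ κ φ).homDegree_enhancedMap s) i).surjective s'
  rw [relabelMap, transportEquiv_apply, Equiv.symm_apply_apply, Pi.smul_apply, smul_eq_mul,
    transportDegEquiv_apply_val, Equiv.symm_apply_apply, enhancedStateRelabelEquiv_apply,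
    (L.relabelTransfer τ κ φ).leeMonomial_enhancedMap i s s₁ _ rfl]
  by_cases hσ : s₁.1.state = s.state
  · rw [hσ]
  · rw [leeMonomial_of_state_ne hσ, mul_zero, mul_zero]

/-- **The relabelling map on canonical generators**: the Lee monomial of `leeState hc t u` goes
to `ε • leeMonomial 0 (leeState (hc.relabel τ κ) t (u ∘ φ⁻¹))`, `ε = ±1` the Koszul
sign of the Seifert state (`enhancedStateRelabelEquiv_leeState`). A relabelling tracks canonical
generators diagonally with a unit constant. [cite: Rasmussen2010, §4 Prop. 4.1] -/
theorem relabelMap_leeMonomial_leeState {c : Fin (2 * L.n) → Bool} (hc : L.IsCheckerboard c)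
    (t : Bool) (u : Fin L.free → Bool) :
    L.relabelMap τ κ φ 0 (L.leeMonomial 0 (L.leeState hc t u)) =
      L.relabelSign τ κ φ L.seifertState •
        (L.relabel τ κ).leeMonomial 0
          ((L.relabel τ κ).leeState (hc.relabel τ κ) t (u ∘ ⇑φ.symm)) := by
  rw [relabelMap_leeMonomial, enhancedStateRelabelEquiv_leeState]
  rfl

end RelabelLee

/-! ## Steps and movies -/

/-- **An elementary move between link Gauss diagrams** (one frame change of a movie): the
birth of a chord-free circle, the death of the last chord-free circle (typed on `L.birth ⟶ L`,
as the counit `deathMap`), the oriented saddle along the arcs leaving two distinct marked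
points, and a renumbering of marked points / chords / free circles. Rasmussen (2010), §4.1;
Bar-Natan (2005), §8. [cite: Rasmussen2010, §4] -/
inductive Step : LinkGaussDiagram → LinkGaussDiagram → Type
  /-- Birth of a chord-free circle (index `0`). [cite: Rasmussen2010, §4] -/
  | birth (L : LinkGaussDiagram) : Step L L.birth
  /-- Death of the last chord-free circle (index `2`), typed `L.birth ⟶ L`.
  [cite: Rasmussen2010, §4] -/
  | death (L : LinkGaussDiagram) : Step L.birth L
  /-- Oriented saddle (index `1`) along the arcs leaving `p ≠ q`.
  [cite: Rasmussen2010, §4] -/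
  | saddle (L : LinkGaussDiagram) (p q : Fin (2 * L.n)) (hpq : p ≠ q) : Step L (L.saddle p q)
  /-- Renumbering of the marked points (`τ`), chords (`κ`) and free circles (`φ`).
  [folklore] -/
  | relabel (L : LinkGaussDiagram) (τ : Equiv.Perm (Fin (2 * L.n))) (κ : Equiv.Perm (Fin L.n))
      (φ : Equiv.Perm (Fin L.free)) : Step L (L.relabel τ κ)

/-- **A movie of link Gauss diagrams**: a finite composable sequence of elementary moves.
Rasmussen (2010), §4.1; Jacobsson (2004), §3; Bar-Natan (2005), §8. [cite: Rasmussen2010, §4] -/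
inductive Movie : LinkGaussDiagram → LinkGaussDiagram → Type
  /-- The constant movie. [folklore] -/
  | nil (L : LinkGaussDiagram) : Movie L L
  /-- A step followed by a movie. [folklore] -/
  | cons {L L' L'' : LinkGaussDiagram} (s : Step L L') (m : Movie L' L'') : Movie L L''

/-- Every step keeps the number of chords (no Reidemeister move is a step). [folklore] -/
theorem Step.n_eq : ∀ {L L' : LinkGaussDiagram}, Step L L' → L'.n = L.n
  | _, _, .birth _ => rfl
  | _, _, .death _ => rfl
  | _, _, .saddle _ _ _ _ => rfl
  | _, _, .relabel _ _ _ _ => rfl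

/-- **Every movie keeps the number of chords**: in particular there is no movie of this layer
from a knot diagram with a crossing to the crossingless `unknots 1` — the Reidemeister steps of
a movie of a slice disc are the business of the next layer. [folklore] -/
theorem Movie.n_eq : ∀ {L L' : LinkGaussDiagram}, Movie L L' → L'.n = L.n
  | _, _, .nil _ => rfl
  | _, _, .cons s m => m.n_eq.trans s.n_eq

/-- The one-step movie. [folklore] -/
def Movie.single (s : Step L L') : Movie L L' := .cons s (.nil L')

/-- Concatenation of movies. [folklore] -/
def Movie.append : {L L' L'' : LinkGaussDiagram} → Movie L L' → Movie L' L'' → Movie L L''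
  | _, _, _, .nil _, m' => m'
  | _, _, _, .cons s m, m' => .cons s (m.append m')

/-! ## The maps of steps and movies on Lee's complex -/

/-- **The chain map of an elementary move** on the cochains of degree `i` of Lee's complex
(`(ℚ, h, t) = (ℚ, 0, 1)`): the unit `birthMap`, the counit `deathMap`, the saddle map
`saddleMap p q 0 1 i`, the signed relabelling isomorphism `relabelMap`. Rasmussen (2010), §4.1,
eq. (4.1). [cite: Rasmussen2010, §4] -/
def Step.map : {L L' : LinkGaussDiagram} → Step L L' → (i : ℤ) →
    ((L.degStates i → ℚ) →ₗ[ℚ] (L'.degStates i → ℚ))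
  | _, _, .birth L, i => L.birthMap ℚ i
  | _, _, .death L, i => L.deathMap ℚ i
  | _, _, .saddle L p q _, i => L.saddleMap p q 0 1 i
  | _, _, .relabel L τ κ φ, i => (L.relabelMap τ κ φ i).toLinearMap

/-- **The composite chain map of a movie** in degree `i`: the composite of the maps of its
steps, in order (`φ_S = φ_{S_k} ∘ ⋯ ∘ φ_{S_1}`). Rasmussen (2010), §4.2.
[cite: Rasmussen2010, §4] -/
def Movie.map : {L L' : LinkGaussDiagram} → Movie L L' → (i : ℤ) →
    ((L.degStates i → ℚ) →ₗ[ℚ] (L'.degStates i → ℚ))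
  | _, _, .nil _, _ => LinearMap.id
  | _, _, .cons s m, i => m.map i ∘ₗ s.map i

/-- The map of the constant movie is the identity. [folklore] -/
@[simp] theorem Movie.map_nil (L : LinkGaussDiagram) (i : ℤ) :
    (Movie.nil L).map i = LinearMap.id := rfl

/-- The map of `s ∷ m` is the map of `m` after the map of `s`. [folklore] -/
@[simp] theorem Movie.map_cons (s : Step L L') (m : Movie L' L'') (i : ℤ) :
    (Movie.cons s m).map i = m.map i ∘ₗ s.map i := rfl

/-- The map of a one-step movie is the map of the step. [folklore] -/
@[simp] theorem Movie.map_single (s : Step L L') (i : ℤ) : (Movie.single s).map i = s.map i :=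
  LinearMap.id_comp _

/-- **The map of a concatenation is the composite of the maps** (functoriality under gluing).
[cite: Rasmussen2010, §4] -/
theorem Movie.map_append : ∀ {L L' L'' : LinkGaussDiagram} (m : Movie L L') (m' : Movie L' L'')
    (i : ℤ), (m.append m').map i = m'.map i ∘ₗ m.map i
  | _, _, _, .nil _, m', i => by rw [Movie.append, Movie.map_nil, LinearMap.comp_id]
  | _, _, _, .cons s m, m', i => by
    rw [Movie.append, Movie.map_cons, Movie.map_cons, Movie.map_append m m' i,
      LinearMap.comp_assoc]

/-! ## The degree shift `χ` -/

/-- **The filtered degree of an elementary move** (Rasmussen's Euler characteristic of the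
elementary cobordism): `+1` for a birth and for a death (`le_qMin_birthMap`, `le_qMin_deathMap`),
`-1` for a saddle (`le_qMin_saddleMap`), `0` for a relabelling. Rasmussen (2010), §4.2.
[cite: Rasmussen2010, §4] -/
def Step.degShift : {L L' : LinkGaussDiagram} → Step L L' → ℤ
  | _, _, .birth _ => 1
  | _, _, .death _ => 1
  | _, _, .saddle _ _ _ _ => -1
  | _, _, .relabel _ _ _ _ => 0

/-- **The filtered degree of a movie**, `χ(S) = #births - #saddles + #deaths` of the presented
cobordism: the sum of the degree shifts of its steps. Rasmussen (2010), §4.2.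
[cite: Rasmussen2010, §4] -/
def Movie.degShift : {L L' : LinkGaussDiagram} → Movie L L' → ℤ
  | _, _, .nil _ => 0
  | _, _, .cons s m => s.degShift + m.degShift

/-- The constant movie has degree shift `0`. [folklore] -/
@[simp] theorem Movie.degShift_nil (L : LinkGaussDiagram) : (Movie.nil L).degShift = 0 := rfl

/-- The degree shift of `s ∷ m`. [folklore] -/
@[simp] theorem Movie.degShift_cons (s : Step L L') (m : Movie L' L'') :
    (Movie.cons s m).degShift = s.degShift + m.degShift := rfl

/-- The degree shift is additive under concatenation. [cite: Rasmussen2010, §4] -/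
theorem Movie.degShift_append : ∀ {L L' L'' : LinkGaussDiagram} (m : Movie L L')
    (m' : Movie L' L''), (m.append m').degShift = m.degShift + m'.degShift
  | _, _, _, .nil _, m' => by rw [Movie.append, Movie.degShift_nil, zero_add]
  | _, _, _, .cons s m, m' => by
    rw [Movie.append, Movie.degShift_cons, Movie.degShift_cons, Movie.degShift_append m m',
      add_assoc]

/-! ## Filtration: the map of a movie is filtered of degree `χ` -/

/-- **Each elementary map is filtered of degree `degShift`** on degree-zero Lee chains:
`k ≤ q(x) ⟹ k + degShift ≤ q(map x)` (`le_qMin_birthMap`, `le_qMin_deathMap`,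
`le_qMin_saddleMap`, `qMin_relabelMap`). Rasmussen (2010), §4.2. [cite: Rasmussen2010, §4] -/
theorem Step.le_qMin_map : ∀ {L L' : LinkGaussDiagram} (s : Step L L') (x : L.degStates 0 → ℚ)
    {k : ℤ}, ((k : WithTop ℤ) : WithBot (WithTop ℤ)) ≤ qMin x →
      (((k + s.degShift : ℤ) : WithTop ℤ) : WithBot (WithTop ℤ)) ≤ qMin (s.map 0 x)
  | _, _, .birth L, x, _, hk => L.le_qMin_birthMap x hk
  | _, _, .death L, x, _, hk => L.le_qMin_deathMap x hk
  | _, _, .saddle L p q _, x, k, hk => by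
    have h := L.le_qMin_saddleMap p q 1 x hk
    rwa [sub_eq_add_neg] at h
  | _, _, .relabel L τ κ φ, x, k, hk => by
    rw [Step.degShift, add_zero, Step.map, LinearEquiv.coe_coe, qMin_relabelMap]
    exact hk

/-- **The map of a movie is filtered of degree `χ = degShift`** on degree-zero Lee chains:
`k ≤ q(x) ⟹ k + m.degShift ≤ q(m.map 0 x)`. Rasmussen (2010), §4.2 ("`φ_S` is a filtered map
of degree `χ(S)`"). [cite: Rasmussen2010, §4] -/
theorem Movie.le_qMin_map : ∀ {L L' : LinkGaussDiagram} (m : Movie L L')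
    (x : L.degStates 0 → ℚ) {k : ℤ},
    ((k : WithTop ℤ) : WithBot (WithTop ℤ)) ≤ qMin x →
      (((k + m.degShift : ℤ) : WithTop ℤ) : WithBot (WithTop ℤ)) ≤ qMin (m.map 0 x)
  | _, _, .nil _, x, k, hk => by rwa [Movie.degShift_nil, add_zero, Movie.map_nil]
  | _, _, .cons s m, x, k, hk => by
    rw [Movie.degShift_cons, ← add_assoc, Movie.map_cons, LinearMap.comp_apply]
    exact m.le_qMin_map _ (s.le_qMin_map x hk)

/-! ## Chain maps: the merge-or-split inputs of the saddles -/

/-- **The chain-map inputs of a step**: nothing for births, deaths and relabellings (chain maps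
outright); for a saddle `(p, q)` of `L` the three realisability hypotheses of
`khovanovD_comp_saddleMap` — every flip of `L` (`hms`) and of `L.saddle p q` (`hms'`) and the
saddle in every state (`hsad`) is a merge or a split. [cite: Rasmussen2010, §4] -/
def Step.MergeOrSplit : {L L' : LinkGaussDiagram} → Step L L' → Prop
  | _, _, .saddle L p q _ =>
      (∀ (σ : L.State) (k : Fin L.n), σ k = false → L.IsMergeAt σ k ∨ L.IsSplitAt σ k) ∧
      (∀ (σ : L.State) (k : Fin L.n), σ k = false →
        (L.saddle p q).IsMergeAt σ k ∨ (L.saddle p q).IsSplitAt σ k) ∧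
      ∀ σ : L.State, L.IsSaddleMerge p q σ ∨ L.IsSaddleSplit p q σ
  | _, _, .birth _ => True
  | _, _, .death _ => True
  | _, _, .relabel _ _ _ _ => True

/-- The chain-map inputs of a movie: those of all its steps. [cite: Rasmussen2010, §4] -/
def Movie.MergeOrSplit : {L L' : LinkGaussDiagram} → Movie L L' → Prop
  | _, _, .nil _ => True
  | _, _, .cons s m => s.MergeOrSplit ∧ m.MergeOrSplit

/-- The inputs of a concatenation are those of the two pieces. [folklore] -/
theorem Movie.mergeOrSplit_append_iff : ∀ {L L' L'' : LinkGaussDiagram} (m : Movie L L')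
    (m' : Movie L' L''), (m.append m').MergeOrSplit ↔ m.MergeOrSplit ∧ m'.MergeOrSplit
  | _, _, _, .nil _, m' => by simp [Movie.append, Movie.MergeOrSplit]
  | _, _, _, .cons s m, m' => by
    rw [Movie.append, Movie.MergeOrSplit, Movie.MergeOrSplit, m.mergeOrSplit_append_iff m',
      and_assoc]

/-- **Each elementary map is a chain map**, `d' ∘ map i = map i' ∘ d` between any two degrees:
`khovanovD_comp_birthMap`, `khovanovD_comp_deathMap`, `khovanovD_comp_saddleMap` (under its
merge-or-split inputs), `khovanovD_comp_relabelMap`. Rasmussen (2010), §4.1, eq. (4.1).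
[cite: Rasmussen2010, §4] -/
theorem Step.khovanovD_comp_map : ∀ {L L' : LinkGaussDiagram} (s : Step L L'),
    s.MergeOrSplit → ∀ i i' : ℤ,
      L'.khovanovD ℚ 0 1 i i' ∘ₗ s.map i = s.map i' ∘ₗ L.khovanovD ℚ 0 1 i i'
  | _, _, .birth L, _, i, i' => L.khovanovD_comp_birthMap ℚ 0 1 i i'
  | _, _, .death L, _, i, i' => L.khovanovD_comp_deathMap ℚ 0 1 i i'
  | _, _, .saddle L p q _, h, i, i' => L.khovanovD_comp_saddleMap p q 0 1 h.1 h.2.1 h.2.2 i i'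
  | _, _, .relabel L τ κ φ, _, i, i' => L.khovanovD_comp_relabelMap τ κ φ 0 1 i i'

/-- **The map of a movie is a chain map**: `d' ∘ m.map i = m.map i' ∘ d` between any two
homological degrees, under the merge-or-split inputs of its saddles. Rasmussen (2010), §4.2.
[cite: Rasmussen2010, §4] -/
theorem Movie.khovanovD_comp_map : ∀ {L L' : LinkGaussDiagram} (m : Movie L L'),
    m.MergeOrSplit → ∀ i i' : ℤ,
      L'.khovanovD ℚ 0 1 i i' ∘ₗ m.map i = m.map i' ∘ₗ L.khovanovD ℚ 0 1 i i'
  | _, _, .nil _, _, i, i' => by rw [Movie.map_nil, Movie.map_nil, LinearMap.comp_id,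
      LinearMap.id_comp]
  | _, _, .cons s m, hm, i, i' => by
    rw [Movie.map_cons, Movie.map_cons, ← LinearMap.comp_assoc, m.khovanovD_comp_map hm.2 i i',
      LinearMap.comp_assoc, s.khovanovD_comp_map hm.1 i i', ← LinearMap.comp_assoc]

/-- **The map of a movie sends degree-zero Lee cycles to cycles.** [cite: Rasmussen2010, §4] -/
theorem Movie.map_mem_leeCycles (m : Movie L L') (hm : m.MergeOrSplit) {z : L.degStates 0 → ℚ}
    (hz : z ∈ L.leeCycles) : m.map 0 z ∈ L'.leeCycles :=
  mem_leeCycles_of_comm (m.khovanovD_comp_map hm 0 (0 + 1)) hz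

/-- **The map of a movie sends degree-zero Lee boundaries to boundaries.**
[cite: Rasmussen2010, §4] -/
theorem Movie.map_mem_range (m : Movie L L') (hm : m.MergeOrSplit) {x : L.degStates 0 → ℚ}
    (hx : x ∈ LinearMap.range (L.khovanovD ℚ 0 1 (0 - 1) 0)) :
    m.map 0 x ∈ LinearMap.range (L'.khovanovD ℚ 0 1 (0 - 1) 0) :=
  mem_range_of_comm (m.khovanovD_comp_map hm (0 - 1) 0) hx

/-- **The map of a movie is a filtered Lee map of degree `χ`** (chain map under the
merge-or-split inputs, filtered of degree `degShift`). Rasmussen (2010), §4.2.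
[cite: Rasmussen2010, §4] -/
theorem Movie.isFilteredLeeMap (m : Movie L L') (hm : m.MergeOrSplit) :
    IsFilteredLeeMap L L' m.degShift (m.map 0) where
  mem_leeCycles _ hz := m.map_mem_leeCycles hm hz
  mem_range _ hx := m.map_mem_range hm hx
  le_qMin x _ hk := m.le_qMin_map x hk

/-- For a movie of nonnegative degree shift (e.g. a concordance, `χ = 0`) the map does not
decrease `qMin` — hypothesis (iii) of the consumer. [cite: Rasmussen2010, §4] -/
theorem Movie.qMin_le_qMin_map (m : Movie L L') (hm : m.MergeOrSplit) (hχ : 0 ≤ m.degShift)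
    (x : L.degStates 0 → ℚ) : qMin x ≤ qMin (m.map 0 x) :=
  (m.isFilteredLeeMap hm).qMin_le hχ x

/-! ## Colourings along a movie -/

/-- **Transport of a colouring of the marked points along a step**: births, deaths and saddles
keep the marked points and the colouring; a relabelling `τ` of the marked points carries `c` to
`c ∘ τ⁻¹` (`IsCheckerboard.relabel`). [cite: Rasmussen2010, §2.3] -/
def Step.colour : {L L' : LinkGaussDiagram} → Step L L' → (Fin (2 * L.n) → Bool) →
    (Fin (2 * L'.n) → Bool)
  | _, _, .birth _, c => c
  | _, _, .death _, c => c
  | _, _, .saddle _ _ _ _, c => c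
  | _, _, .relabel _ τ _ _, c => c ∘ ⇑τ.symm

/-- Transport of a colouring along a movie. [cite: Rasmussen2010, §2.3] -/
def Movie.colour : {L L' : LinkGaussDiagram} → Movie L L' → (Fin (2 * L.n) → Bool) →
    (Fin (2 * L'.n) → Bool)
  | _, _, .nil _, c => c
  | _, _, .cons s m, c => m.colour (s.colour c)

/-- The constant movie does not change the colouring. [folklore] -/
@[simp] theorem Movie.colour_nil (L : LinkGaussDiagram) (c : Fin (2 * L.n) → Bool) :
    (Movie.nil L).colour c = c := rfl

/-- Colour transport along `s ∷ m`. [folklore] -/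
@[simp] theorem Movie.colour_cons (s : Step L L') (m : Movie L' L'') (c : Fin (2 * L.n) → Bool) :
    (Movie.cons s m).colour c = m.colour (s.colour c) := rfl

/-- **Coherence of a step for a colouring**: a saddle `(p, q)` must join arcs of the same
colour (`c p = c q`: an oriented band, `IsCheckerboard.saddle`) and be a merge or a split in
every state (the realisability input `hsad` of `khovanovD_comp_saddleMap`); no condition on the
other steps. [cite: Rasmussen2010, §4] -/
def Step.Coherent : {L L' : LinkGaussDiagram} → Step L L' → (Fin (2 * L.n) → Bool) → Prop
  | _, _, .saddle L p q _, c =>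
      c p = c q ∧ ∀ σ : L.State, L.IsSaddleMerge p q σ ∨ L.IsSaddleSplit p q σ
  | _, _, .birth _, _ => True
  | _, _, .death _, _ => True
  | _, _, .relabel _ _ _ _, _ => True

/-- **Coherence of a movie for an initial colouring**: every step is coherent for the colouring
transported up to it. [cite: Rasmussen2010, §4] -/
def Movie.Coherent : {L L' : LinkGaussDiagram} → Movie L L' → (Fin (2 * L.n) → Bool) → Prop
  | _, _, .nil _, _ => True
  | _, _, .cons s m, c => s.Coherent c ∧ m.Coherent (s.colour c)

/-- **Checkerboard colourings are transported along coherent steps** (`IsCheckerboard.birth`,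
`isCheckerboard_birth_iff`, `IsCheckerboard.saddle`, `IsCheckerboard.relabel`).
[cite: Rasmussen2010, §2.3] -/
theorem IsCheckerboard.step : ∀ {L L' : LinkGaussDiagram} (s : Step L L')
    {c : Fin (2 * L.n) → Bool}, L.IsCheckerboard c → s.Coherent c →
      L'.IsCheckerboard (s.colour c)
  | _, _, .birth _, _, hc, _ => hc.birth
  | _, _, .death L, c, hc, _ => (L.isCheckerboard_birth_iff c).1 hc
  | _, _, .saddle _ _ _ _, _, hc, hs => hc.saddle hs.1
  | _, _, .relabel _ τ κ _, _, hc, _ => hc.relabel τ κ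

/-- **Checkerboard colourings are transported along coherent movies.**
[cite: Rasmussen2010, §2.3] -/
theorem IsCheckerboard.movie : ∀ {L L' : LinkGaussDiagram} (m : Movie L L')
    {c : Fin (2 * L.n) → Bool}, L.IsCheckerboard c → m.Coherent c →
      L'.IsCheckerboard (m.colour c)
  | _, _, .nil _, _, hc, _ => hc
  | _, _, .cons s m, _, hc, hm => IsCheckerboard.movie m (hc.step s hm.1) hm.2

/-- **A coherent step of a checkerboard-coloured diagram has its chain-map inputs**, except
`hsad` which coherence carries: `hms`, `hms'` come from the dichotomy of `LinkKhDichotomy`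
(`dichotomy_of_isCheckerboard`, `dichotomy_saddle`). [cite: Rasmussen2010, §4] -/
theorem Step.Coherent.mergeOrSplit : ∀ {L L' : LinkGaussDiagram} {s : Step L L'}
    {c : Fin (2 * L.n) → Bool}, L.IsCheckerboard c → s.Coherent c → s.MergeOrSplit
  | _, _, .birth _, _, _, _ => trivial
  | _, _, .death _, _, _, _ => trivial
  | _, _, .saddle L _ _ _, _, hc, hs =>
    ⟨L.dichotomy_of_isCheckerboard hc, L.dichotomy_saddle hc hs.1, hs.2⟩
  | _, _, .relabel _ _ _ _, _, _, _ => trivial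

/-- **A coherent movie of a checkerboard-coloured diagram has all its chain-map inputs**: of
the hypotheses of `khovanovD_comp_saddleMap` only the `hsad` recorded in `Coherent` remain.
[cite: Rasmussen2010, §4] -/
theorem Movie.Coherent.mergeOrSplit : ∀ {L L' : LinkGaussDiagram} {m : Movie L L'}
    {c : Fin (2 * L.n) → Bool}, L.IsCheckerboard c → m.Coherent c → m.MergeOrSplit
  | _, _, .nil _, _, _, _ => trivial
  | _, _, .cons s _, _, hc, hm =>
    ⟨Step.Coherent.mergeOrSplit hc hm.1, Movie.Coherent.mergeOrSplit (hc.step s hm.1) hm.2⟩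

/-- **Coherent movies of checkerboard-coloured diagrams give filtered Lee maps of degree `χ`.**
[cite: Rasmussen2010, §4] -/
theorem Movie.Coherent.isFilteredLeeMap {c : Fin (2 * L.n) → Bool} {m : Movie L L'}
    (hc : L.IsCheckerboard c) (hm : m.Coherent c) : IsFilteredLeeMap L L' m.degShift (m.map 0) :=
  m.isFilteredLeeMap (hm.mergeOrSplit hc)

/-- Coloured form: the map of a coherent movie of a checkerboard-coloured diagram sends
degree-zero Lee cycles to cycles. [cite: Rasmussen2010, §4] -/
theorem Movie.Coherent.map_mem_leeCycles {c : Fin (2 * L.n) → Bool} {m : Movie L L'}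
    (hc : L.IsCheckerboard c) (hm : m.Coherent c) {z : L.degStates 0 → ℚ}
    (hz : z ∈ L.leeCycles) : m.map 0 z ∈ L'.leeCycles :=
  m.map_mem_leeCycles (hm.mergeOrSplit hc) hz

/-- Coloured form: the map of a coherent movie of a checkerboard-coloured diagram sends
degree-zero Lee boundaries to boundaries. [cite: Rasmussen2010, §4] -/
theorem Movie.Coherent.map_mem_range {c : Fin (2 * L.n) → Bool} {m : Movie L L'}
    (hc : L.IsCheckerboard c) (hm : m.Coherent c) {x : L.degStates 0 → ℚ}
    (hx : x ∈ LinearMap.range (L.khovanovD ℚ 0 1 (0 - 1) 0)) :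
    m.map 0 x ∈ LinearMap.range (L'.khovanovD ℚ 0 1 (0 - 1) 0) :=
  m.map_mem_range (hm.mergeOrSplit hc) hx

/-- Coloured form: for a coherent movie of nonnegative degree shift the map does not decrease
`qMin`. [cite: Rasmussen2010, §4] -/
theorem Movie.Coherent.qMin_le_qMin_map {c : Fin (2 * L.n) → Bool} {m : Movie L L'}
    (hc : L.IsCheckerboard c) (hm : m.Coherent c) (hχ : 0 ≤ m.degShift) (x : L.degStates 0 → ℚ) :
    qMin x ≤ qMin (m.map 0 x) :=
  (hm.isFilteredLeeMap hc).qMin_le hχ x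

/-! ## Counting critical points: `χ = #births - #saddles + #deaths` -/

/-- Number of births of a step (`1` or `0`). [folklore] -/
def Step.birthCount : {L L' : LinkGaussDiagram} → Step L L' → ℕ
  | _, _, .birth _ => 1
  | _, _, .death _ => 0
  | _, _, .saddle _ _ _ _ => 0
  | _, _, .relabel _ _ _ _ => 0

/-- Number of deaths of a step (`1` or `0`). [folklore] -/
def Step.deathCount : {L L' : LinkGaussDiagram} → Step L L' → ℕ
  | _, _, .birth _ => 0
  | _, _, .death _ => 1
  | _, _, .saddle _ _ _ _ => 0
  | _, _, .relabel _ _ _ _ => 0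

/-- Number of saddles of a step (`1` or `0`). [folklore] -/
def Step.saddleCount : {L L' : LinkGaussDiagram} → Step L L' → ℕ
  | _, _, .birth _ => 0
  | _, _, .death _ => 0
  | _, _, .saddle _ _ _ _ => 1
  | _, _, .relabel _ _ _ _ => 0

/-- Number of births of a movie (index-`0` critical points). [folklore] -/
def Movie.birthCount : {L L' : LinkGaussDiagram} → Movie L L' → ℕ
  | _, _, .nil _ => 0
  | _, _, .cons s m => s.birthCount + m.birthCount

/-- Number of deaths of a movie (index-`2` critical points). [folklore] -/
def Movie.deathCount : {L L' : LinkGaussDiagram} → Movie L L' → ℕ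
  | _, _, .nil _ => 0
  | _, _, .cons s m => s.deathCount + m.deathCount

/-- Number of saddles of a movie (index-`1` critical points). [folklore] -/
def Movie.saddleCount : {L L' : LinkGaussDiagram} → Movie L L' → ℕ
  | _, _, .nil _ => 0
  | _, _, .cons s m => s.saddleCount + m.saddleCount

/-- `degShift` of a step is `#births - #saddles + #deaths`. [folklore] -/
theorem Step.degShift_eq : ∀ {L L' : LinkGaussDiagram} (s : Step L L'),
    s.degShift = (s.birthCount : ℤ) - s.saddleCount + s.deathCount
  | _, _, .birth _ => rfl
  | _, _, .death _ => rfl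
  | _, _, .saddle _ _ _ _ => rfl
  | _, _, .relabel _ _ _ _ => rfl

/-- **`χ = #births - #saddles + #deaths`**: the degree shift of a movie is the Euler
characteristic of the presented surface computed from its critical points.
[cite: Rasmussen2010, §4] -/
theorem Movie.degShift_eq : ∀ {L L' : LinkGaussDiagram} (m : Movie L L'),
    m.degShift = (m.birthCount : ℤ) - m.saddleCount + m.deathCount
  | _, _, .nil _ => rfl
  | _, _, .cons s m => by
    rw [Movie.degShift_cons, s.degShift_eq, m.degShift_eq, Movie.birthCount, Movie.saddleCount,
      Movie.deathCount]
    push_cast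
    ring

/-! ## Transport of free-circle labels along steps without births / deaths -/

/-- **Forward transport of free-circle labels** along a step without birth: a death forgets
the last label, a saddle keeps the labels, a relabelling renumbers them (for a birth: the
label `𝐚` on the newborn circle, a junk value). [folklore] -/
def Step.push : {L L' : LinkGaussDiagram} → Step L L' → (Fin L.free → Bool) → (Fin L'.free → Bool)
  | _, _, .birth _, u => Fin.snoc u false
  | _, _, .death _, u => Fin.init u
  | _, _, .saddle _ _ _ _, u => u
  | _, _, .relabel _ _ _ φ, u => u ∘ ⇑φ.symm

/-- **Backward transport of free-circle labels** along a step without death: a birth forgets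
the label of the newborn circle, a saddle keeps the labels, a relabelling renumbers them back
(for a death: the label `𝐛` on the dying circle, a junk value). [folklore] -/
def Step.pull : {L L' : LinkGaussDiagram} → Step L L' → (Fin L'.free → Bool) → (Fin L.free → Bool)
  | _, _, .birth _, u' => Fin.init u'
  | _, _, .death _, u' => Fin.snoc u' true
  | _, _, .saddle _ _ _ _, u' => u'
  | _, _, .relabel _ _ _ φ, u' => u' ∘ ⇑φ

/-- Forward transport of free-circle labels along a movie. [folklore] -/
def Movie.push : {L L' : LinkGaussDiagram} → Movie L L' → (Fin L.free → Bool) → (Fin L'.free → Bool)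
  | _, _, .nil _, u => u
  | _, _, .cons s m, u => m.push (s.push u)

/-- Backward transport of free-circle labels along a movie. [folklore] -/
def Movie.pull : {L L' : LinkGaussDiagram} → Movie L L' → (Fin L'.free → Bool) → (Fin L.free → Bool)
  | _, _, .nil _, u' => u'
  | _, _, .cons s m, u' => s.pull (m.pull u')

/-- Without deaths the backward transport of labels is surjective (every initial labelling is
pulled back from some final one). [folklore] -/
theorem Step.pull_surjective : ∀ {L L' : LinkGaussDiagram} (s : Step L L'),
    s.deathCount = 0 → Surjective s.pull
  | _, _, .birth _, _ => fun u ↦ ⟨Fin.snoc u false, Fin.init_snoc _ _⟩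
  | _, _, .death _, h => absurd h one_ne_zero
  | _, _, .saddle _ _ _ _, _ => surjective_id
  | _, _, .relabel _ _ _ φ, _ => fun u ↦ ⟨u ∘ ⇑φ.symm, by ext j; simp [Step.pull]⟩

/-- Without deaths the backward transport of labels along a movie is surjective. [folklore] -/
theorem Movie.pull_surjective : ∀ {L L' : LinkGaussDiagram} (m : Movie L L'),
    m.deathCount = 0 → Surjective m.pull
  | _, _, .nil _, _ => surjective_id
  | _, _, .cons s m, h => by
    have hs : s.deathCount = 0 := by unfold Movie.deathCount at h; omega
    have hm : m.deathCount = 0 := by unfold Movie.deathCount at h; omega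
    exact (s.pull_surjective hs).comp (m.pull_surjective hm)

/-! ## Sanity -/

/-- **Sanity (a sphere component kills everything).** The movie "birth, then death of the
newborn circle" presents a cobordism with a closed sphere component; its map vanishes
identically (`ε ∘ ι = 0`, `deathMap_comp_birthMap`) although it has degree shift `2`: the
nonvanishing of Prop. 4.1 / Cor. 4.2 needs the connectivity hypotheses, not only `χ`.
[cite: Rasmussen2010, §4 Prop. 4.1] -/
theorem Movie.map_birth_death (L : LinkGaussDiagram) (i : ℤ) :
    (Movie.cons (Step.birth L) (Movie.single (Step.death L))).map i = 0 := by
  rw [Movie.map_cons, Movie.map_single]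
  exact L.deathMap_comp_birthMap ℚ i

/-- The sphere movie has degree shift `χ(S²) = 2`. [folklore] -/
theorem Movie.degShift_birth_death (L : LinkGaussDiagram) :
    (Movie.cons (Step.birth L) (Movie.single (Step.death L))).degShift = 2 := rfl

/-- **Sanity (`unknots`).** The movie of `k` successive births from the empty diagram
`unknots 0` to the `k`-component unlink `unknots k` (`(unknots j).birth = unknots (j + 1)`
definitionally). [cite: Rasmussen2010, §4] -/
def Movie.births : (k : ℕ) → Movie (unknots 0) (unknots k)
  | 0 => .nil _
  | k + 1 => (Movie.births k).append (Movie.single (Step.birth (unknots k)))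

/-- The movie of `k` births has degree shift `k` (`k` discs). [folklore] -/
theorem Movie.degShift_births : ∀ k : ℕ, (Movie.births k).degShift = k
  | 0 => rfl
  | k + 1 => by
    rw [Movie.births, Movie.degShift_append, Movie.degShift_births k]
    rfl

end LinkGaussDiagram

end Literature.Topology.FourManifolds

end
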